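import Summits.HodgeConjecture.CorCM.IrreducibleOddWeightsHelly
import Summits.HodgeConjecture.CorCM.IrreducibleOddWeightsIndexBound
import Summits.HodgeConjecture.CorCM.IrreducibleOddWeightsCoveringFamily
import HarnessLib

/-!
# The Helly number of degeneracy is at most the index of an abelian subgroup — with no representation listed

COR-CM (cell `pub-hodgecm2`, binder seat `b16` gen 59, count-neutral claim INDEX BOUND, file F3 — abstract `G`-set level;
theorems only, no definition, no named fact, no `sorry`).  NEW as stated, hence under `Summits/`.  HONEST FRAMING:
unconditional finite-dimensional linear algebra over `ℚ` about the rank of families of CM types (= `dim` of the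
Mumford–Tate group of a product of CM abelian varieties: nondegenerate family = `Hg(∏ A_i) = ∏ Hg(A_i)` of maximal
rank, then the Hodge conjecture holds on all products of the `A_i`, tree `CMAlgebra.IsNondegenerateFamily.…`);
`HC_CM` is neither used nor asserted.

THE RESULT.  A group `G` permutes finite slots `E_i` (`i ∈ I`), `Φ_i ⊆ E_i` are CM types for a conjugation `ρ`,
`Σ = ⊔_i Φ_i`.  Let `A ≤ G` be a subgroup of finite index `t = [G : A]` whose elements act on every slot through
PAIRWISE COMMUTING permutations (e.g. `A` abelian; for `G = Aut(ℂ)` on `Hom(K_i, ℂ)`: the preimage of an abelian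
subgroup of `Gal(L/ℚ)`, `L ⊇ K_i` Galois).  THEN

* **`typeRank_sigmaType_eq_iff_forall_card_le_index_succ_of_smul_comm`**: `Σ` is nondegenerate
  (`rank Σ = |⊔ E_i|/2 + 1`) IFF every non-empty sub-family of AT MOST `t + 1` members is nondegenerate;
* **`exists_card_le_index_succ_typeRank_sigmaType_ne_of_smul_comm`**: a degenerate family contains a degenerate
  sub-family of at most `t + 1` members;
* **`typeRank_sigmaType_eq_iff_forall_card_le_two_of_smul_comm`**: if all of `G` acts through pairwise commuting
  permutations (abelian image), PAIRS decide.

No representation appears in these statements: the covering list of pairwise disjoint irreducibles EXISTS (F2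
`…CoveringFamily`), the index bound `d_k ≤ [G:A] · δ_k` holds for each of them (F1 `…IndexBound`), and the Helly
number of gen 58 (`…Helly`) does the rest.  §1 keeps the versions with a given covering list (useful together with the
computable criteria of gen 57).  `t = 1`: abelian closures, pairs (the tree's abelian criterion, recovered); `t = 2`:
every Galois closure with an abelian subgroup of index two — dihedral, quaternion, semidihedral, modular, generalised
dihedral … — TRIPLES decide, and pairs do not in general (gen 55: the `SD₁₆` octics have all pairs additive and no
additive triple).  The CM-field reading is F4 `…IndexHellyCMFields`.

## References

* [Serre1977] J.-P. Serre, *Linear Representations of Finite Groups*, GTM 42 (1977), §1.4 Thm. 2, §2.2 Prop. 4, §3.1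
  Cor. to Thm. 9, §12.2.
* [Mai1989] L. Mai, *Lower bounds for the ranks of CM types*, J. Number Theory 32 (1989), §2 Prop. 1.
* [Gordon1999HodgeAVSurvey] B. B. Gordon, *A survey of the Hodge conjecture for abelian varieties*, §3, 7.5–7.7.
* [Deligne1982HodgeCycles] P. Deligne, *Hodge cycles on abelian varieties*, LNM 900 (1982), I Ex. 3.7.
-/

set_option autoImplicit false

noncomputable section

open scoped BigOperators

universe u u' v w

namespace Summit.HodgeConjecture.CorCM.IrrOdd

open Literature.NumberTheory.ComplexMultiplication

variable {G : Type w} [Group G]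

/-! ### §1 The Helly number is at most the index (covering irreducibles given) -/

section Helly

variable {I : Type u} {E : I → Type v} [∀ i, MulAction G (E i)] [Fintype I] [∀ i, Fintype (E i)]
  {K : Type u'} [Fintype K] {V : K → Type*} [∀ k, AddCommGroup (V k)] [∀ k, Module ℚ (V k)]
  [∀ k, FiniteDimensional ℚ (V k)]

/-- **THE HELLY NUMBER IS AT MOST THE INDEX OF A SUBGROUP ACTING THROUGH COMMUTING OPERATORS.**  Pairwise
non-isomorphic irreducibles `(π_k, V_k)` covering every member `U(Φ_i)` of a family of CM types, and a finite-index
subgroup `A ≤ G` whose elements act on each `V_k` through pairwise commuting operators (e.g. `A` abelian).  THEN the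
family is nondegenerate — `rank(Σ) = |⊔_i E_i|/2 + 1`, `Hg(∏_i A_i) = ∏ Hg(A_i)` of maximal rank — IFF every non-empty
sub-family with AT MOST `[G : A] + 1` MEMBERS is nondegenerate (§2: `d_k ≤ [G:A] · δ_k`, and the Helly number of gen 58).
[cite: Serre1977, §3.1 Cor. to Thm. 9] [cite: Mai1989, §2 Prop. 1 (proof)] [cite: Gordon1999HodgeAVSurvey, 7.5–7.7] -/
theorem typeRank_sigmaType_eq_iff_forall_card_le_index_succ [∀ i, Nonempty (E i)] [Nonempty I] {ρ : G}
    {Φ : ∀ i, Set (E i)} (h : ∀ i, IsCMTypeWith ρ (Φ i)) (π : ∀ k, Representation ℚ G (V k))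
    (hirr : ∀ k, (π k).IsIrreducible) (hne : ∀ k l, k ≠ l → ∀ S : (π k).IntertwiningMap (π l), S = 0)
    (hcov : ∀ (i : I) (P : Submodule ℚ (E i → ℚ)), P ≤ antiSpan G (Φ i) → P ≠ ⊥ →
      (∀ (g : G) (a : E i → ℚ), a ∈ P → (fun s => a (g • s)) ∈ P) →
      ∃ k, ∃ T : (E i → ℚ) →ₗ[ℚ] V k,
        (∀ (g : G) (a : E i → ℚ), T (fun s => a (g⁻¹ • s)) = π k g (T a)) ∧ ∃ a ∈ P, T a ≠ 0)
    (A : Subgroup G) [A.FiniteIndex] (hcomm : ∀ k, ∀ a ∈ A, ∀ b ∈ A, π k a * π k b = π k b * π k a) :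
    typeRank G (sigmaType Φ) = Fintype.card (Σ i, E i) / 2 + 1 ↔
      ∀ T : Finset I, T.Nonempty → T.card ≤ A.index + 1 →
        typeRank G (sigmaType fun j : (T : Set I) => Φ j) = Fintype.card (Σ j : (T : Set I), E j) / 2 + 1 :=
  typeRank_sigmaType_eq_iff_forall_card_le h π hirr hne hcov A.index fun k =>
    finrank_le_index_mul_finrank_intertwiningMap (π k) (hirr k) A (hcomm k)

/-- **A degenerate family has a degenerate sub-family of at most `[G : A] + 1` members** (`A ≤ G` of finite index
acting on the covering irreducibles through commuting operators): degeneracy of `Hg(∏_i A_i)` is witnessed on a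
product of `≤ [G:A] + 1` of the factors. [cite: Serre1977, §3.1 Cor. to Thm. 9] [cite: Mai1989, §2 Prop. 1 (proof)] -/
theorem exists_card_le_index_succ_typeRank_sigmaType_ne [∀ i, Nonempty (E i)] [Nonempty I] {ρ : G}
    {Φ : ∀ i, Set (E i)} (h : ∀ i, IsCMTypeWith ρ (Φ i)) (π : ∀ k, Representation ℚ G (V k))
    (hirr : ∀ k, (π k).IsIrreducible) (hne : ∀ k l, k ≠ l → ∀ S : (π k).IntertwiningMap (π l), S = 0)
    (hcov : ∀ (i : I) (P : Submodule ℚ (E i → ℚ)), P ≤ antiSpan G (Φ i) → P ≠ ⊥ →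
      (∀ (g : G) (a : E i → ℚ), a ∈ P → (fun s => a (g • s)) ∈ P) →
      ∃ k, ∃ T : (E i → ℚ) →ₗ[ℚ] V k,
        (∀ (g : G) (a : E i → ℚ), T (fun s => a (g⁻¹ • s)) = π k g (T a)) ∧ ∃ a ∈ P, T a ≠ 0)
    (A : Subgroup G) [A.FiniteIndex] (hcomm : ∀ k, ∀ a ∈ A, ∀ b ∈ A, π k a * π k b = π k b * π k a)
    (hdeg : typeRank G (sigmaType Φ) ≠ Fintype.card (Σ i, E i) / 2 + 1) :
    ∃ T : Finset I, T.Nonempty ∧ T.card ≤ A.index + 1 ∧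
      typeRank G (sigmaType fun j : (T : Set I) => Φ j) ≠ Fintype.card (Σ j : (T : Set I), E j) / 2 + 1 :=
  exists_card_le_typeRank_sigmaType_ne h π hirr hne hcov A.index
    (fun k => finrank_le_index_mul_finrank_intertwiningMap (π k) (hirr k) A (hcomm k)) hdeg

/-- **Commuting actions: PAIRS DECIDE.**  If `G` acts on every covering irreducible through pairwise commuting
operators (e.g. `G` abelian, or all `V_k` factor through an abelian quotient), a family of CM types is nondegenerate
iff every sub-family of at most two members is — the tree's abelian pairwise criterion, recovered without listing the
irreducible representations' dimensions. [cite: Gordon1999HodgeAVSurvey, 7.5–7.7] [cite: Serre1977, §3.1 Thm. 9] -/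
theorem typeRank_sigmaType_eq_iff_forall_card_le_two_of_comm [∀ i, Nonempty (E i)] [Nonempty I] {ρ : G}
    {Φ : ∀ i, Set (E i)} (h : ∀ i, IsCMTypeWith ρ (Φ i)) (π : ∀ k, Representation ℚ G (V k))
    (hirr : ∀ k, (π k).IsIrreducible) (hne : ∀ k l, k ≠ l → ∀ S : (π k).IntertwiningMap (π l), S = 0)
    (hcov : ∀ (i : I) (P : Submodule ℚ (E i → ℚ)), P ≤ antiSpan G (Φ i) → P ≠ ⊥ →
      (∀ (g : G) (a : E i → ℚ), a ∈ P → (fun s => a (g • s)) ∈ P) →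
      ∃ k, ∃ T : (E i → ℚ) →ₗ[ℚ] V k,
        (∀ (g : G) (a : E i → ℚ), T (fun s => a (g⁻¹ • s)) = π k g (T a)) ∧ ∃ a ∈ P, T a ≠ 0)
    (hcomm : ∀ k (a b : G), π k a * π k b = π k b * π k a) :
    typeRank G (sigmaType Φ) = Fintype.card (Σ i, E i) / 2 + 1 ↔
      ∀ T : Finset I, T.Nonempty → T.card ≤ 2 →
        typeRank G (sigmaType fun j : (T : Set I) => Φ j) = Fintype.card (Σ j : (T : Set I), E j) / 2 + 1 :=
  typeRank_sigmaType_eq_iff_forall_card_le_two h π hirr hne hcov fun k =>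
    finrank_eq_finrank_intertwiningMap_of_comm (π k) (hirr k) (hcomm k)

end Helly

/-! ### §2 No representation listed -/

section NoList

variable {I : Type u} {E : I → Type v} [∀ i, MulAction G (E i)] [Fintype I] [∀ i, Fintype (E i)]

/-- **THE HELLY NUMBER IS AT MOST THE INDEX — NO REPRESENTATION LISTED.**  `G` permutes finite slots `E_i`, `Φ_i` are
CM types for `ρ`, and `A ≤ G` is a subgroup of finite index whose elements act on every slot through PAIRWISE
COMMUTING permutations (e.g. `A` abelian).  THEN the family is nondegenerate — `rank(Σ) = |⊔_i E_i|/2 + 1`,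
`Hg(∏_i A_i) = ∏ Hg(A_i)` of maximal rank — IFF every non-empty sub-family with AT MOST `[G : A] + 1` MEMBERS is
nondegenerate.  (A covering list of pairwise disjoint irreducibles exists, F2; `A` acts on each through commuting
operators, so `d_k ≤ [G:A] δ_k`, F1; Helly, gen 58.) [cite: Serre1977, §1.4 Thm. 2 and §3.1 Cor. to Thm. 9]
[cite: Mai1989, §2 Prop. 1 (proof)] [cite: Gordon1999HodgeAVSurvey, 7.5–7.7] -/
theorem typeRank_sigmaType_eq_iff_forall_card_le_index_succ_of_smul_comm [∀ i, Nonempty (E i)] [Nonempty I]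
    {ρ : G} {Φ : ∀ i, Set (E i)} (h : ∀ i, IsCMTypeWith ρ (Φ i)) (A : Subgroup G) [A.FiniteIndex]
    (hA : ∀ a ∈ A, ∀ b ∈ A, ∀ (i : I) (s : E i), a • b • s = b • a • s) :
    typeRank G (sigmaType Φ) = Fintype.card (Σ i, E i) / 2 + 1 ↔
      ∀ T : Finset I, T.Nonempty → T.card ≤ A.index + 1 →
        typeRank G (sigmaType fun j : (T : Set I) => Φ j) = Fintype.card (Σ j : (T : Set I), E j) / 2 + 1 := by
  classical
  obtain ⟨n, S, π, K, hπ, hirr, hne, hcov⟩ := exists_covering_irreducibles_slots (G := G) (E := E)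
  refine typeRank_sigmaType_eq_iff_forall_card_le_index_succ (K := K) (V := fun k : K => S k.1) h
    (fun k => π k.1) (fun k => hirr k.1) (fun k l hkl T => hne k.1 k.2 l.1 l.2 (fun h' => hkl (Subtype.ext h')) T)
    (fun i P _ hP0 hPst => ?_) A fun k => commute_of_smul_comm (π k.1) (hπ k.1) A hA
  obtain ⟨k, hk, T, hT, a, ha, ha0⟩ := hcov i P hP0 hPst
  exact ⟨⟨k, hk⟩, T, hT, a, ha, ha0⟩

/-- **A degenerate family has a degenerate sub-family of at most `[G : A] + 1` members** — `A ≤ G` of finite index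
acting on every slot through pairwise commuting permutations; no representation listed.
[cite: Serre1977, §3.1 Cor. to Thm. 9] [cite: Mai1989, §2 Prop. 1 (proof)] [cite: Gordon1999HodgeAVSurvey, 7.5–7.7] -/
theorem exists_card_le_index_succ_typeRank_sigmaType_ne_of_smul_comm [∀ i, Nonempty (E i)] [Nonempty I]
    {ρ : G} {Φ : ∀ i, Set (E i)} (h : ∀ i, IsCMTypeWith ρ (Φ i)) (A : Subgroup G) [A.FiniteIndex]
    (hA : ∀ a ∈ A, ∀ b ∈ A, ∀ (i : I) (s : E i), a • b • s = b • a • s)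
    (hdeg : typeRank G (sigmaType Φ) ≠ Fintype.card (Σ i, E i) / 2 + 1) :
    ∃ T : Finset I, T.Nonempty ∧ T.card ≤ A.index + 1 ∧
      typeRank G (sigmaType fun j : (T : Set I) => Φ j) ≠ Fintype.card (Σ j : (T : Set I), E j) / 2 + 1 := by
  by_contra hall
  push Not at hall
  exact hdeg ((typeRank_sigmaType_eq_iff_forall_card_le_index_succ_of_smul_comm h A hA).2
    fun T hT hTc => hall T hT hTc)

/-- **Commuting permutations: PAIRS DECIDE — no representation listed.**  If all elements of `G` act on every slot
through pairwise commuting permutations (the action factors through an abelian group), a family of CM types is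
nondegenerate iff every sub-family of at most two members is (the tree's abelian pairwise criterion, recovered for
arbitrary slots). [cite: Gordon1999HodgeAVSurvey, 7.5–7.7] [cite: Serre1977, §3.1 Thm. 9] -/
theorem typeRank_sigmaType_eq_iff_forall_card_le_two_of_smul_comm [∀ i, Nonempty (E i)] [Nonempty I]
    {ρ : G} {Φ : ∀ i, Set (E i)} (h : ∀ i, IsCMTypeWith ρ (Φ i))
    (hG : ∀ (a b : G) (i : I) (s : E i), a • b • s = b • a • s) :
    typeRank G (sigmaType Φ) = Fintype.card (Σ i, E i) / 2 + 1 ↔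
      ∀ T : Finset I, T.Nonempty → T.card ≤ 2 →
        typeRank G (sigmaType fun j : (T : Set I) => Φ j) = Fintype.card (Σ j : (T : Set I), E j) / 2 + 1 := by
  have hmain := typeRank_sigmaType_eq_iff_forall_card_le_index_succ_of_smul_comm h (⊤ : Subgroup G)
    fun a _ b _ i s => hG a b i s
  rwa [Subgroup.index_top] at hmain

end NoList

end Summit.HodgeConjecture.CorCM.IrrOdd

end
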